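import Summits.AtomisticToContinuum.HydrodynamicLimit.Theorems.RelayRaceLocalityLightConeInLawCone
import Summits.AtomisticToContinuum.HydrodynamicLimit.Theorems.RelayRaceLocalityLightConeInLawStubProfileIdOne
import Summits.AtomisticToContinuum.HydrodynamicLimit.Theorems.RelayRaceLocalityLightConeInLawStubProfileId
import Literature.MathematicalPhysics.KineticTheory.HardSphereEulerProofs

/-!
# `LightConeInLaw` holds conditionally on the generalised conjunct (HL-gen)
(crux stmt-AtomisticToContinuum-12500, line `Sketch`, `--supports`; route `RelayRaceLocality`,
sub-problem `HydrodynamicLimit`; lead c1)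

The outcome of the line lead's cycle, as one kernel-checked implication about the ROUTE DECL:

  `lightConeInLaw_of_hydroLimitGeneral : (HL-gen) → RelayRaceLocality.LightConeInLaw`,

where (HL-gen) is the packing-guarded hydrodynamic limit for general comparison families
`(ε N, n N)`, `n N · (ε N)³ → σ³`, `ε N → 0` (the body of `HydroLimitInBand`, stmt-3093, for the
crux's comparison gases; written out as the hypothesis). It is the composition of the registered
skeleton of the line (`lightConeInLaw_of_core`: statics stubs 1–3, landed, + the core as a
hypothesis) with `DoD.stub_core_of_hydroLimitGeneral` (the core from (HL-gen), the finite domain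
of dependence of classical hs-Euler solutions having been PROVED, `DoD.reducedConeUniqueness`).
This is a CONDITIONAL result (the gate's `proof.conditional`): the crux is not closed; together
with `Necessary.particleNumberContinuity_of_lightConeInLaw` (crux ⇒ PNC) and
`Dominance.nearConstantShortTimeHL_of_hydroLimitGeneral` ((HL-gen) ⇒ the route's crux 12502) it
tells the planner exactly where the crux sits.
-/

namespace Summit.AtomisticToContinuum.HydrodynamicLimit.Theorems.LightConeInLawSketch.DoD

open scoped BigOperators Topology Classical ENNReal
open Filter Set MeasureTheory
open Literature.MathematicalPhysics.KineticTheory Literature.Analysis.FluidPDE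
  Literature.Analysis.FunctionSpaces
open Summit.AtomisticToContinuum.HydrodynamicLimit.Theorems.LightConeInLawSketch

noncomputable section

/-- **The composition of the line `Sketch`, in the tree.** The crux `LightConeInLaw` from the
statement of its one open registered stub `stub_core` (taken as a hypothesis, verbatim) and the
three landed statics stubs `TimeZero.stub_timeZero`, `ProfileIdOne.stub_profileIdOne`,
`ProfileId.stub_profileId` — the proof of `LightConeInLaw_of` of the registered skeleton
`Cruxes/LightConeInLaw/Lines/Sketch.lean` (rev 7), copied here so that the conditional result
below is a theorem of the tree: `t = 0` → stub 1; `0 < t`, `R − c t ≤ 0` → `χ ≡ 0`; else the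
core fed by stubs 2–3. -/
theorem lightConeInLaw_of_core
    (hc :    ∃ η₀ : ℝ, 0 < η₀ ∧ ∀ M : ℝ, 0 < M → ∃ c : ℝ, 0 < c ∧
    ∀ (a₁ θ₁ a₂ θ₂ : T3 → ℝ) (u₁ u₂ : T3 → V3), Continuous a₁ → Continuous θ₁ → Continuous u₁ →
      Continuous a₂ → Continuous θ₂ → Continuous u₂ → (∀ x, 0 < a₁ x) → (∀ x, 0 < θ₁ x) →
      (∀ x, 0 < a₂ x) → (∀ x, 0 < θ₂ x) →
    ∃ σ₀ : ℝ, 0 < σ₀ ∧ ∀ (σ₁ σ₂ : ℝ), 0 < σ₁ → σ₁ < σ₀ → 0 < σ₂ → σ₂ < σ₀ →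
    ∀ n₂ : ℕ → ℕ, Tendsto (fun N => (n₂ N : ℝ) * hsDiameter σ₁ N ^ 3) atTop (𝓝 (σ₂ ^ 3)) →
    ∀ (T₁ T₂ : ℝ) (ρ₁ Θ₁ ρ₂ Θ₂ : ℝ → T3 → ℝ) (U₁ U₂ : ℝ → T3 → V3),
      IsHardSphereEulerSolution σ₁ T₁ ρ₁ U₁ Θ₁ → IsHardSphereEulerSolution σ₂ T₂ ρ₂ U₂ Θ₂ →
    ∀ (Φ₁ : (N : ℕ) → HardSphereFlow G3 (hsDiameter σ₁ N) (N + 1))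
      (Φ₂ : (N : ℕ) → HardSphereFlow G3 (hsDiameter σ₁ N) (n₂ N)),
    (∀ N, IsProbabilityMeasure (localGibbsLaw σ₁ a₁ u₁ θ₁ N (Φ₁ N))) →
    (∀ N, IsProbabilityMeasure (particleLaw (Φ₂ N)
      (canonicalDensity G3 (hsDiameter σ₁ N) (n₂ N) (localGibbsProfile a₂ u₂ θ₂)))) →
    TendstoHydroFieldsAt (fun N => localGibbsLaw σ₁ a₁ u₁ θ₁ N (Φ₁ N)) Φ₁ ρ₁ U₁ Θ₁ 0 →
    LLNAt n₂ (fun N => particleLaw (Φ₂ N)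
      (canonicalDensity G3 (hsDiameter σ₁ N) (n₂ N) (localGibbsProfile a₂ u₂ θ₂))) Φ₂
      (ρ₂ 0) (U₂ 0) (Θ₂ 0) 0 →
    (∀ x, U₁ 0 x = u₁ x ∧ Θ₁ 0 x = θ₁ x) → (∀ x, U₂ 0 x = u₂ x ∧ Θ₂ 0 x = θ₂ x) →
    ∀ t : ℝ, 0 < t → t < T₁ → t < T₂ →
      (∀ s ∈ Set.Icc 0 t, ∀ x, ρ₁ s x * σ₁ ^ 3 < η₀ ∧ Θ₁ s x ≤ M ∧ ‖U₁ s x‖ ≤ M ∧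
        ρ₂ s x * σ₂ ^ 3 < η₀ ∧ Θ₂ s x ≤ M ∧ ‖U₂ s x‖ ≤ M) →
    ∀ (x₀ : T3) (R : ℝ), 0 < R - c * t →
      (∀ x, Torus.euclidDist x x₀ < R →
        ρ₁ 0 x * σ₁ ^ 3 = ρ₂ 0 x * σ₂ ^ 3 ∧ U₁ 0 x = U₂ 0 x ∧ Θ₁ 0 x = Θ₂ 0 x) →
    ∀ χ : T3 → ℝ, Continuous χ → (∀ x, R - c * t ≤ Torus.euclidDist x x₀ → χ x = 0) →
    ∀ F : ℝ × V3 × ℝ → ℝ, LipschitzWith 1 F → (∀ p, |F p| ≤ 1) →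
      Tendsto (fun N =>
        (∫ z, F (σ₁ ^ 3 * empiricalDensityField ((Φ₁ N).flow t z) χ,
            (σ₁ ^ 3) • empiricalMomentumField ((Φ₁ N).flow t z) χ,
            σ₁ ^ 3 * empiricalEnergyField ((Φ₁ N).flow t z) χ) ∂(localGibbsLaw σ₁ a₁ u₁ θ₁ N (Φ₁ N))) -
        ∫ z, F (σ₂ ^ 3 * empiricalDensityField ((Φ₂ N).flow t z) χ,
            (σ₂ ^ 3) • empiricalMomentumField ((Φ₂ N).flow t z) χ,
            σ₂ ^ 3 * empiricalEnergyField ((Φ₂ N).flow t z) χ) ∂(particleLaw (Φ₂ N)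
              (canonicalDensity G3 (hsDiameter σ₁ N) (n₂ N) (localGibbsProfile a₂ u₂ θ₂)))) atTop (𝓝 0)) :
    Summit.AtomisticToContinuum.HydrodynamicLimit.Theses.RelayRaceLocality.LightConeInLaw := by
  have H0 := TimeZero.stub_timeZero
  have H1 := ProfileIdOne.stub_profileIdOne
  have H2 := ProfileId.stub_profileId
  obtain ⟨η₀, hη₀, Hc⟩ := hc
  refine ⟨η₀, hη₀, fun M hM => ?_⟩
  obtain ⟨c, hc0, Hc'⟩ := Hc M hM
  refine ⟨c, hc0, ?_⟩
  intro a₁ θ₁ a₂ θ₂ u₁ u₂ ha₁ hθ₁ hu₁ ha₂ hθ₂ hu₂ ha₁0 hθ₁0 ha₂0 hθ₂0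
  obtain ⟨σ₀, hσ₀, H⟩ := Hc' a₁ θ₁ a₂ θ₂ u₁ u₂ ha₁ hθ₁ hu₁ ha₂ hθ₂ hu₂ ha₁0 hθ₁0 ha₂0 hθ₂0
  refine ⟨σ₀, hσ₀, ?_⟩
  intro σ₁ σ₂ hσ₁ hσ₁' hσ₂ hσ₂' n₂ hn₂ T₁ T₂ ρ₁ Θ₁ ρ₂ Θ₂ U₁ U₂ hsol₁ hsol₂ Φ₁ Φ₂ P₁ P₂ hP₁ hP₂
    hL₁ hL₂ t ht htT₁ htT₂ hguard x₀ R hagree χ hχ hsupp F hF hFb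
  rcases ht.eq_or_lt with rfl | htpos
  · -- the slice `t = 0`
    have hsupp' : ∀ x, R ≤ Torus.euclidDist x x₀ → χ x = 0 := fun x hx =>
      hsupp x (by simpa using hx)
    exact H0 (fun N => N + 1) n₂ (fun N => hsDiameter σ₁ N) (fun N => hsDiameter σ₁ N) σ₁ σ₂
      hσ₁ hσ₂ Φ₁ Φ₂ P₁ P₂ hP₁ hP₂ (ρ₁ 0) (Θ₁ 0) (ρ₂ 0) (Θ₂ 0) (U₁ 0) (U₂ 0) hL₁ hL₂ x₀ R
      hagree χ hχ hsupp' F hF hFb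
  by_cases hR : 0 < R - c * t
  · -- positive time, non-trivial support: the core, fed the profile identifications
    have h0T₁ : (0 : ℝ) ∈ Set.Ico 0 T₁ := ⟨le_rfl, ht.trans_lt htT₁⟩
    have h0T₂ : (0 : ℝ) ∈ Set.Ico 0 T₂ := ⟨le_rfl, ht.trans_lt htT₂⟩
    have hid₁ : ∀ x, U₁ 0 x = u₁ x ∧ Θ₁ 0 x = θ₁ x :=
      H1 a₁ θ₁ u₁ ha₁ hθ₁ hu₁ ha₁0 hθ₁0 σ₁ hσ₁ Φ₁ hP₁ (ρ₁ 0) (Θ₁ 0) (U₁ 0)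
        (hsol₁.smooth_density.isSmooth_slice h0T₁).continuous
        (hsol₁.smooth_velocity.isSmooth_slice h0T₁).continuous
        (hsol₁.smooth_temperature.isSmooth_slice h0T₁).continuous
        (hsol₁.density_pos 0 h0T₁) hL₁
    have hid₂ : ∀ x, U₂ 0 x = u₂ x ∧ Θ₂ 0 x = θ₂ x :=
      H2 a₂ θ₂ u₂ ha₂ hθ₂ hu₂ ha₂0 hθ₂0 n₂ (fun N => hsDiameter σ₁ N)
        (tendsto_atTop_of_mul_hsDiameter σ₁ σ₂ hσ₁ hσ₂ n₂ hn₂) Φ₂ hP₂ (ρ₂ 0) (Θ₂ 0) (U₂ 0)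
        (hsol₂.smooth_density.isSmooth_slice h0T₂).continuous
        (hsol₂.smooth_velocity.isSmooth_slice h0T₂).continuous
        (hsol₂.smooth_temperature.isSmooth_slice h0T₂).continuous
        (hsol₂.density_pos 0 h0T₂) hL₂
    exact H σ₁ σ₂ hσ₁ hσ₁' hσ₂ hσ₂' n₂ hn₂ T₁ T₂ ρ₁ Θ₁ ρ₂ Θ₂ U₁ U₂ hsol₁ hsol₂ Φ₁ Φ₂ hP₁ hP₂
      hL₁ hL₂ hid₁ hid₂ t htpos htT₁ htT₂ hguard x₀ R hR hagree χ hχ hsupp F hF hFb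
  · -- positive time, `R - c t ≤ 0`: the test function vanishes identically
    have hzero : ∀ x, χ x = 0 := fun x =>
      hsupp x ((not_lt.mp hR).trans (norm_nonneg _))
    have hχ0 : χ = fun _ => 0 := funext hzero
    subst hχ0
    have hconst : (fun N =>
        (∫ z, F (σ₁ ^ 3 * empiricalDensityField ((Φ₁ N).flow t z) (fun _ => 0),
            (σ₁ ^ 3) • empiricalMomentumField ((Φ₁ N).flow t z) (fun _ => 0),
            σ₁ ^ 3 * empiricalEnergyField ((Φ₁ N).flow t z) (fun _ => 0)) ∂(P₁ N)) -
        ∫ z, F (σ₂ ^ 3 * empiricalDensityField ((Φ₂ N).flow t z) (fun _ => 0),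
            (σ₂ ^ 3) • empiricalMomentumField ((Φ₂ N).flow t z) (fun _ => 0),
            σ₂ ^ 3 * empiricalEnergyField ((Φ₂ N).flow t z) (fun _ => 0)) ∂(P₂ N)) =
        fun _ => 0 := by
      funext N
      haveI := hP₁ N
      haveI := hP₂ N
      simp [empiricalDensityField, empiricalMomentumField, empiricalEnergyField]
    rw [hconst]
    exact tendsto_const_nhds

/-- **`LightConeInLaw` conditionally on (HL-gen).** The two-copy light cone in law for the
hard-sphere gas at fixed reduced density follows from the packing-guarded hydrodynamic limit for
general comparison families (registered sub-goal; CONDITIONAL result — the hypothesis is an open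
statement of hydrodynamic-limit type, not a fact of the literature). -/
theorem lightConeInLaw_of_hydroLimitGeneral :
    (∃ η₁ : ℝ, 0 < η₁ ∧
      ∀ (a θ : T3 → ℝ) (u : T3 → V3), Continuous a → Continuous θ → Continuous u →
        (∀ x, 0 < a x) → (∀ x, 0 < θ x) →
      ∃ σ₀ : ℝ, 0 < σ₀ ∧ ∀ σ : ℝ, 0 < σ → σ < σ₀ →
      ∀ (ε : ℕ → ℝ) (n : ℕ → ℕ), (∀ N, 0 < ε N) → Tendsto ε atTop (𝓝 0) →
        Tendsto (fun N => (n N : ℝ) * ε N ^ 3) atTop (𝓝 (σ ^ 3)) →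
      ∀ (T : ℝ) (ρ Θ : ℝ → T3 → ℝ) (U : ℝ → T3 → V3), IsHardSphereEulerSolution σ T ρ U Θ →
      ∀ Φ : (N : ℕ) → HardSphereFlow G3 (ε N) (n N),
      (∀ N, IsProbabilityMeasure
        (particleLaw (Φ N) (canonicalDensity G3 (ε N) (n N) (localGibbsProfile a u θ)))) →
      LLNAt n (fun N => particleLaw (Φ N)
        (canonicalDensity G3 (ε N) (n N) (localGibbsProfile a u θ))) Φ (ρ 0) (U 0) (Θ 0) 0 →
      ∀ t : ℝ, 0 ≤ t → t < T → (∀ s ∈ Set.Icc 0 t, ∀ x, ρ s x * σ ^ 3 < η₁) →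
      LLNAt n (fun N => particleLaw (Φ N)
        (canonicalDensity G3 (ε N) (n N) (localGibbsProfile a u θ))) Φ (ρ t) (U t) (Θ t) t) →
    Summit.AtomisticToContinuum.HydrodynamicLimit.Theses.RelayRaceLocality.LightConeInLaw :=
  fun hHL => lightConeInLaw_of_core (stub_core_of_hydroLimitGeneral hHL)

end

end Summit.AtomisticToContinuum.HydrodynamicLimit.Theorems.LightConeInLawSketch.DoD
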